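import Mathlib.Analysis.SpecialFunctions.Sqrt
import Mathlib.Analysis.ODE.Gronwall
import Summits.NavierStokesRegularity.FluidComputer.BlockQuadGate

/-!
# Block design — pseudo-orbits of the quadratic gate: the AMPLITUDE-UNIFORM toolkit

Design-level, elementary real analysis; no `sorry`; canonical axioms. HONEST FRAMING: low prior,
high value-of-information experiment on Tao's machine paradigm; NOT a claim that NS blows up.

`BlockQuadBudget.lean` priced the GENERIC certificate of the local layer (`LocalCircuit`:
a Lipschitz constant `L` of the design field and the budget `gronwallBound 0 L ε τc ≤ δsh`) for the
quadratic design field `quadVF k η (a,b) = (−kηab, ka²)` of `BlockQuadGate.lean`: void on the open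
window (no Lipschitz constant), `ε ≤ 2·10⁻¹¹` on the bounded one — generic Grönwall charges the
full instability `e^{L τc}`, `L ≥ 2k·a_max`, of the field. This file proves the STRUCTURAL
estimates that replace it. An `ε`-PSEUDO-ORBIT of `quadVF k η` on `[0, T]` is a continuous
`z : ℝ → ℝ × ℝ` with a right derivative `w t` at every `t ∈ [0, T)` such that
`‖w t − quadVF k η (z t)‖ ≤ ε` (the shape of the `defect` field of `LocalCircuit`; sup norm on
`ℝ × ℝ`). With `W = a² + ηb²`, `R = √W`, and `0 ≤ η ≤ 1`:

* `pseudo_energy_band` — `(1 + W₀) e^{−2εt} ≤ 1 + W(t) ≤ (1 + W₀) e^{2εt}`: the design field is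
  tangent to the energy ellipses (`quadVF_radial`), so only the defect moves the energy, at
  relative rate `≤ 2ε`. No `k`, no amplitude.
* `pseudo_snd_lower` — `b(t) ≥ b(0) − εt` (`ḃ = ka² + e₂ ≥ −ε`, `k ≥ 0`): the hand-over to block
  `n+1` is almost monotone.
* `pseudo_gap_decay` — the GAP `p = R − √η b ≥ 0` (note `a² = p (R + √η b)`) satisfies
  `p' ≤ −k√η (R + √η b) p + 3ε`, hence `p(t) ≤ p(0) e^{−κt} + 3ε/κ` for any constant
  `0 < κ ≤ k√η (R + √η b)` valid along the orbit: the crossing is SELF-ACCELERATING and contracts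
  the gap at a rate proportional to the amplitude, down to a defect floor `3ε/κ`.

All three are scalar Grönwall inequalities with rate `±2ε`, `0`, and `−κ < 0` respectively — never
with the Lipschitz constant of the field. `BlockQuadTransit.lean` combines them into the
pseudo-orbit delayed abrupt transition for the lane's windows.

WHAT THIS IS AND IS NOT (honest). Nothing in this file refers to Navier–Stokes: the pointwise
leakage defect `ε` of a true NS trajectory read through a wavelet pair is the idea-bound quantity
(ASSEMBLY §2g.9(j) (β2b)); that NS produces the quadratic design field at all is presumably false
for a bare two-wavelet pair (degree count, §2g.9 (β1)). This file only says what a defect of size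
`ε` can do to the three quantities the architecture reads. [cite: Tao2016AveragedNS, §1.3
pp. 10–11]
-/


open Set Filter Topology

namespace Summit.NavierStokesRegularity.FluidComputer

open Literature.Analysis.FluidPDE Literature.Analysis.FluidPDE.FluidComputer

namespace BlockDesign

/-! ## Pointwise identities and bounds -/

/-- The quadratic design field is tangent to the energy ellipses `a² + ηb² = const`:
`a·V₁ + η b·V₂ = 0`. [folklore] -/
theorem quadVF_radial (k η : ℝ) (p : ℝ × ℝ) :
    p.1 * (quadVF k η p).1 + η * p.2 * (quadVF k η p).2 = 0 := by
  simp only [quadVF]; ring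

/-- Sup-norm control of the first component of a difference. [folklore] -/
theorem abs_fst_sub_le {w V : ℝ × ℝ} {ε : ℝ} (h : ‖w - V‖ ≤ ε) : |w.1 - V.1| ≤ ε := by
  have h1 := norm_fst_le (w - V)
  rw [Prod.fst_sub, Real.norm_eq_abs] at h1
  exact h1.trans h

/-- Sup-norm control of the second component of a difference. [folklore] -/
theorem abs_snd_sub_le {w V : ℝ × ℝ} {ε : ℝ} (h : ‖w - V‖ ≤ ε) : |w.2 - V.2| ≤ ε := by
  have h1 := norm_snd_le (w - V)
  rw [Prod.snd_sub, Real.norm_eq_abs] at h1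
  exact h1.trans h

/-- RADIAL DEFECT BOUND: if `‖w − quadVF k η p‖ ≤ ε` then `|a w₁ + η b w₂| ≤ (|a| + η|b|) ε` —
the field itself contributes nothing (`quadVF_radial`). [folklore] -/
theorem abs_radial_le {η : ℝ} (hη : 0 ≤ η) (k : ℝ) {p w : ℝ × ℝ} {ε : ℝ}
    (h : ‖w - quadVF k η p‖ ≤ ε) :
    |p.1 * w.1 + η * p.2 * w.2| ≤ (|p.1| + η * |p.2|) * ε := by
  have h1 := abs_fst_sub_le h
  have h2 := abs_snd_sub_le h
  have hid : p.1 * w.1 + η * p.2 * w.2 =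
      p.1 * (w.1 - (quadVF k η p).1) + η * p.2 * (w.2 - (quadVF k η p).2) := by
    linear_combination quadVF_radial k η p
  rw [hid]
  calc |p.1 * (w.1 - (quadVF k η p).1) + η * p.2 * (w.2 - (quadVF k η p).2)|
      ≤ |p.1 * (w.1 - (quadVF k η p).1)| + |η * p.2 * (w.2 - (quadVF k η p).2)| :=
        abs_add_le _ _
    _ = |p.1| * |w.1 - (quadVF k η p).1| + η * |p.2| * |w.2 - (quadVF k η p).2| := by
      rw [abs_mul, abs_mul, abs_mul, abs_of_nonneg hη]
    _ ≤ |p.1| * ε + η * |p.2| * ε := by gcongr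
    _ = (|p.1| + η * |p.2|) * ε := by ring

/-- `|a| ≤ R` with `R = qRad η (a,b)` (`η ≥ 0`). [folklore] -/
theorem abs_fst_le_qRad {η : ℝ} (hη : 0 ≤ η) (p : ℝ × ℝ) : |p.1| ≤ qRad η p := by
  have hW : pairEnergy η p = p.1 ^ 2 + η * p.2 ^ 2 := rfl
  unfold qRad; rw [← Real.sqrt_sq_eq_abs]
  exact Real.sqrt_le_sqrt (by rw [hW]; nlinarith [sq_nonneg p.2])

/-- `√η |b| ≤ R` with `R = qRad η (a,b)` (`η ≥ 0`). [folklore] -/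
theorem sqrt_mul_abs_snd_le_qRad {η : ℝ} (hη : 0 ≤ η) (p : ℝ × ℝ) :
    Real.sqrt η * |p.2| ≤ qRad η p := by
  have hW : pairEnergy η p = p.1 ^ 2 + η * p.2 ^ 2 := rfl
  unfold qRad; rw [← Real.sqrt_sq_eq_abs, ← Real.sqrt_mul hη]
  exact Real.sqrt_le_sqrt (by rw [hW]; nlinarith [sq_nonneg p.1])

/-- `|a| + η|b| ≤ (1 + √η)·R` with `R = qRad η (a,b) = √(a² + ηb²)` (`η ≥ 0`). [folklore] -/
theorem abs_add_le_qRad {η : ℝ} (hη : 0 ≤ η) (p : ℝ × ℝ) :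
    |p.1| + η * |p.2| ≤ (1 + Real.sqrt η) * qRad η p := by
  have ha := abs_fst_le_qRad hη p
  have hb := sqrt_mul_abs_snd_le_qRad hη p
  have hs : η * |p.2| = Real.sqrt η * (Real.sqrt η * |p.2|) := by
    rw [← mul_assoc, Real.mul_self_sqrt hη]
  have hq : 0 ≤ Real.sqrt η := Real.sqrt_nonneg η
  rw [hs]
  calc |p.1| + Real.sqrt η * (Real.sqrt η * |p.2|)
      ≤ qRad η p + Real.sqrt η * qRad η p := by gcongr
    _ = (1 + Real.sqrt η) * qRad η p := by ring

/-! ## Derivatives along a curve -/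

/-- First component of a right derivative. [folklore] -/
theorem hasDerivWithinAt_fst_comp {z : ℝ → ℝ × ℝ} {w : ℝ × ℝ} {s : Set ℝ} {t : ℝ}
    (hz : HasDerivWithinAt z w s t) : HasDerivWithinAt (fun x => (z x).1) w.1 s t :=
  (hasFDerivAt_fst (𝕜 := ℝ) (E := ℝ) (F := ℝ) (p := z t)).comp_hasDerivWithinAt t hz

/-- Second component of a right derivative. [folklore] -/
theorem hasDerivWithinAt_snd_comp {z : ℝ → ℝ × ℝ} {w : ℝ × ℝ} {s : Set ℝ} {t : ℝ}
    (hz : HasDerivWithinAt z w s t) : HasDerivWithinAt (fun x => (z x).2) w.2 s t :=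
  (hasFDerivAt_snd (𝕜 := ℝ) (E := ℝ) (F := ℝ) (p := z t)).comp_hasDerivWithinAt t hz

/-- Chain rule for a square along a curve: `(f²)' = 2 f f'`. [folklore] -/
theorem hasDerivWithinAt_sq_comp {f : ℝ → ℝ} {f' : ℝ} {s : Set ℝ} {x : ℝ}
    (hf : HasDerivWithinAt f f' s x) : HasDerivWithinAt (fun y => f y ^ 2) (2 * f x * f') s x := by
  simpa using hf.fun_pow 2

/-- Chain rule for the two-block energy along a curve: `(a² + ηb²)' = 2(a a' + η b b')`.
[folklore] -/
theorem hasDerivWithinAt_pairEnergy_comp {z : ℝ → ℝ × ℝ} {w : ℝ × ℝ} {s : Set ℝ} {t : ℝ}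
    (hz : HasDerivWithinAt z w s t) (η : ℝ) :
    HasDerivWithinAt (fun x => pairEnergy η (z x))
      (2 * ((z t).1 * w.1 + η * (z t).2 * w.2)) s t := by
  have h1 := hasDerivWithinAt_sq_comp (hasDerivWithinAt_fst_comp hz)
  have h2 := (hasDerivWithinAt_sq_comp (hasDerivWithinAt_snd_comp hz)).const_mul η
  have key := h1.add h2
  have hfun : (fun x => pairEnergy η (z x)) = fun x => (z x).1 ^ 2 + η * (z x).2 ^ 2 := rfl
  rw [hfun]
  exact key.congr_deriv (by ring)

/-- Continuity of the two-block energy along a continuous curve. [folklore] -/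
theorem continuousOn_pairEnergy_comp {z : ℝ → ℝ × ℝ} {s : Set ℝ} (hz : ContinuousOn z s) (η : ℝ) :
    ContinuousOn (fun x => pairEnergy η (z x)) s := by
  have hfun : (fun x => pairEnergy η (z x)) = fun x => (z x).1 ^ 2 + η * (z x).2 ^ 2 := rfl
  rw [hfun]
  exact (hz.fst.pow 2).add (continuousOn_const.mul (hz.snd.pow 2))

/-! ## The energy band along a pseudo-orbit -/

/-- ENERGY BAND: along an `ε`-pseudo-orbit of `quadVF k η` (`0 ≤ η ≤ 1`) on `[0, T]`,
`(1 + W₀) e^{−2εt} ≤ 1 + W(t) ≤ (1 + W₀) e^{2εt}` with `W = a² + ηb²` (from the radial identity: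
`|W'| ≤ 2(|a| + η|b|)ε ≤ 4Rε ≤ 2ε(1 + W)`, and Grönwall both ways). Amplitude-uniform. [folklore] -/
theorem pseudo_energy_band {η : ℝ} (hη0 : 0 ≤ η) (hη1 : η ≤ 1) (k : ℝ) {ε T : ℝ}
    {z w : ℝ → ℝ × ℝ} (hcont : ContinuousOn z (Icc 0 T))
    (hderiv : ∀ t ∈ Ico 0 T, HasDerivWithinAt z (w t) (Ici t) t)
    (hdef : ∀ t ∈ Ico 0 T, ‖w t - quadVF k η (z t)‖ ≤ ε) :
    ∀ t ∈ Icc 0 T, (1 + pairEnergy η (z 0)) * Real.exp (-(2 * ε) * t) ≤ 1 + pairEnergy η (z t) ∧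
      1 + pairEnergy η (z t) ≤ (1 + pairEnergy η (z 0)) * Real.exp (2 * ε * t) := by
  set f : ℝ → ℝ := fun x => 1 + pairEnergy η (z x) with hfdef
  have hf : ContinuousOn f (Icc 0 T) :=
    continuousOn_const.add (continuousOn_pairEnergy_comp hcont η)
  have hf' : ∀ x ∈ Ico 0 T, HasDerivWithinAt f
      (2 * ((z x).1 * (w x).1 + η * (z x).2 * (w x).2)) (Ici x) x :=
    fun x hx => (hasDerivWithinAt_pairEnergy_comp (hderiv x hx) η).const_add 1
  have hfpos : ∀ x, 0 < f x := fun x => by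
    have := pairEnergy_nonneg hη0 (z x); simp only [hfdef]; linarith
  -- the key pointwise bound `|f'| ≤ 2ε f`
  have key : ∀ x ∈ Ico 0 T,
      |2 * ((z x).1 * (w x).1 + η * (z x).2 * (w x).2)| ≤ 2 * ε * f x := by
    intro x hx
    have hε : 0 ≤ ε := (norm_nonneg _).trans (hdef x hx)
    have h1 := abs_radial_le hη0 k (hdef x hx)
    have h2 := abs_add_le_qRad hη0 (z x)
    have hs1 : Real.sqrt η ≤ 1 := Real.sqrt_le_one.mpr hη1
    have hR0 : 0 ≤ qRad η (z x) := Real.sqrt_nonneg _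
    have hR2 : qRad η (z x) ^ 2 = pairEnergy η (z x) := Real.sq_sqrt (pairEnergy_nonneg hη0 _)
    have h3 : (1 + Real.sqrt η) * qRad η (z x) ≤ f x := by
      simp only [hfdef]; nlinarith [sq_nonneg (qRad η (z x) - 1)]
    rw [abs_mul, abs_two]
    calc 2 * |(z x).1 * (w x).1 + η * (z x).2 * (w x).2|
        ≤ 2 * ((|(z x).1| + η * |(z x).2|) * ε) := by linarith
      _ ≤ 2 * (f x * ε) := by gcongr; exact h2.trans h3
      _ = 2 * ε * f x := by ring
  intro t ht
  constructor
  · -- lower bound: Grönwall for `−f` with rate `−2ε`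
    have hg : ContinuousOn (fun x => -f x) (Icc 0 T) := hf.neg
    have h := le_gronwallBound_of_liminf_deriv_right_le (f := fun x => -f x)
      (f' := fun x => -(2 * ((z x).1 * (w x).1 + η * (z x).2 * (w x).2)))
      (δ := -f 0) (K := -(2 * ε)) (ε := 0) (a := 0) (b := T) hg
      (fun x hx r hr => by
        simpa [slope_def_module, smul_eq_mul] using ((hf' x hx).neg).liminf_right_slope_le hr)
      le_rfl (fun x hx => by
        have := key x hx
        have h' := neg_abs_le (2 * ((z x).1 * (w x).1 + η * (z x).2 * (w x).2))
        nlinarith [h', this]) t ht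
    rw [gronwallBound_ε0, sub_zero] at h
    simp only [hfdef] at h ⊢
    nlinarith [h]
  · -- upper bound: Grönwall for `f` with rate `2ε`
    have h := norm_le_gronwallBound_of_norm_deriv_right_le (f := f)
      (f' := fun x => 2 * ((z x).1 * (w x).1 + η * (z x).2 * (w x).2))
      (δ := f 0) (K := 2 * ε) (ε := 0) (a := 0) (b := T) hf hf'
      (by rw [Real.norm_eq_abs, abs_of_pos (hfpos 0)])
      (fun x hx => by
        rw [Real.norm_eq_abs, Real.norm_eq_abs, abs_of_pos (hfpos x), add_zero]
        exact key x hx) t ht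
    rw [gronwallBound_ε0, sub_zero, Real.norm_eq_abs, abs_of_pos (hfpos t)] at h
    simpa only [hfdef] using h

/-! ## The second component is almost non-decreasing -/

/-- Along an `ε`-pseudo-orbit of `quadVF k η` (`k ≥ 0`) on `[0, T]`: `b(t) ≥ b(0) − εt`
(`ḃ = ka² + e₂ ≥ −ε`). [folklore] -/
theorem pseudo_snd_lower {η k : ℝ} (hk : 0 ≤ k) {ε T : ℝ} {z w : ℝ → ℝ × ℝ}
    (hcont : ContinuousOn z (Icc 0 T))
    (hderiv : ∀ t ∈ Ico 0 T, HasDerivWithinAt z (w t) (Ici t) t)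
    (hdef : ∀ t ∈ Ico 0 T, ‖w t - quadVF k η (z t)‖ ≤ ε) :
    ∀ t ∈ Icc 0 T, (z 0).2 - ε * t ≤ (z t).2 := by
  have hg : ContinuousOn (fun x => -(z x).2) (Icc 0 T) := hcont.snd.neg
  intro t ht
  have h := le_gronwallBound_of_liminf_deriv_right_le (f := fun x => -(z x).2)
    (f' := fun x => -(w x).2) (δ := -(z 0).2) (K := 0) (ε := ε) (a := 0) (b := T) hg
    (fun x hx r hr => by
      simpa [slope_def_module, smul_eq_mul] using
        ((hasDerivWithinAt_snd_comp (hderiv x hx)).neg).liminf_right_slope_le hr)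
    le_rfl (fun x hx => by
      have h2 := abs_snd_sub_le (hdef x hx)
      have hV : (quadVF k η (z x)).2 = k * (z x).1 ^ 2 := rfl
      rw [hV] at h2
      have h3 := (abs_le.1 h2).1
      nlinarith [sq_nonneg (z x).1]) t ht
  simp only [gronwallBound_K0, sub_zero] at h
  linarith

/-! ## The gap `R − √η b` decays (amplitude-uniform) -/

/-- GAP DECAY. Along an `ε`-pseudo-orbit of `quadVF k η` (`0 ≤ η ≤ 1`, `k ≥ 0`, `ε ≥ 0`) on
`[0, T]` with non-vanishing energy, let `p = R − √η b` (`R = √(a² + ηb²)`; `p ≥ 0`,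
`a² = p (R + √η b)`). If `0 < κ ≤ k√η (R + √η b)` along `[0, T)`, then
`p(t) ≤ p(0) e^{−κt} + 3ε/κ` (from `p' = −k√η(R + √η b) p + O(3ε)` and the scalar Grönwall
inequality with NEGATIVE rate). No Lipschitz constant, no amplitude enters. [folklore] -/
theorem pseudo_gap_decay {η : ℝ} (hη0 : 0 ≤ η) (hη1 : η ≤ 1) (k : ℝ) {κ ε T : ℝ}
    (hκ0 : 0 < κ) (hε : 0 ≤ ε) {z w : ℝ → ℝ × ℝ} (hcont : ContinuousOn z (Icc 0 T))
    (hderiv : ∀ t ∈ Ico 0 T, HasDerivWithinAt z (w t) (Ici t) t)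
    (hdef : ∀ t ∈ Ico 0 T, ‖w t - quadVF k η (z t)‖ ≤ ε)
    (hW : ∀ t ∈ Ico 0 T, pairEnergy η (z t) ≠ 0)
    (hκ : ∀ t ∈ Ico 0 T, κ ≤ k * Real.sqrt η * (qRad η (z t) + Real.sqrt η * (z t).2)) :
    ∀ t ∈ Icc 0 T, qRad η (z t) - Real.sqrt η * (z t).2
      ≤ (qRad η (z 0) - Real.sqrt η * (z 0).2) * Real.exp (-κ * t) + 3 * ε / κ := by
  set f : ℝ → ℝ := fun x => qRad η (z x) - Real.sqrt η * (z x).2 with hfdef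
  have hf : ContinuousOn f (Icc 0 T) :=
    (continuousOn_pairEnergy_comp hcont η).sqrt.sub (continuousOn_const.mul hcont.snd)
  have hf' : ∀ x ∈ Ico 0 T, HasDerivWithinAt f
      ((2 * ((z x).1 * (w x).1 + η * (z x).2 * (w x).2)) / (2 * Real.sqrt (pairEnergy η (z x)))
        - Real.sqrt η * (w x).2) (Ici x) x :=
    fun x hx => ((hasDerivWithinAt_pairEnergy_comp (hderiv x hx) η).sqrt (hW x hx)).sub
      ((hasDerivWithinAt_snd_comp (hderiv x hx)).const_mul (Real.sqrt η))
  have hs0 : 0 ≤ Real.sqrt η := Real.sqrt_nonneg η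
  have hs1 : Real.sqrt η ≤ 1 := Real.sqrt_le_one.mpr hη1
  have hse : Real.sqrt η ^ 2 = η := Real.sq_sqrt hη0
  -- the pointwise differential inequality `f' ≤ −κ f + 3ε`
  have bound : ∀ x ∈ Ico 0 T,
      (2 * ((z x).1 * (w x).1 + η * (z x).2 * (w x).2)) / (2 * Real.sqrt (pairEnergy η (z x)))
        - Real.sqrt η * (w x).2 ≤ -κ * f x + 3 * ε := by
    intro x hx
    have hR : 0 < Real.sqrt (pairEnergy η (z x)) :=
      Real.sqrt_pos.2 (lt_of_le_of_ne (pairEnergy_nonneg hη0 _) (hW x hx).symm)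
    have hRq : Real.sqrt (pairEnergy η (z x)) = qRad η (z x) := rfl
    have hR2 : qRad η (z x) ^ 2 = (z x).1 ^ 2 + η * (z x).2 ^ 2 :=
      Real.sq_sqrt (pairEnergy_nonneg hη0 _)
    -- (i) the radial term is `≤ 2ε`
    have h1 : (2 * ((z x).1 * (w x).1 + η * (z x).2 * (w x).2)) /
        (2 * Real.sqrt (pairEnergy η (z x))) ≤ 2 * ε := by
      rw [mul_div_mul_left _ _ (two_ne_zero), div_le_iff₀ hR, hRq]
      calc (z x).1 * (w x).1 + η * (z x).2 * (w x).2
          ≤ |(z x).1 * (w x).1 + η * (z x).2 * (w x).2| := le_abs_self _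
        _ ≤ (|(z x).1| + η * |(z x).2|) * ε := abs_radial_le hη0 k (hdef x hx)
        _ ≤ ((1 + Real.sqrt η) * qRad η (z x)) * ε := by
          gcongr; exact abs_add_le_qRad hη0 (z x)
        _ = (1 + Real.sqrt η) * (qRad η (z x) * ε) := by ring
        _ ≤ 2 * (qRad η (z x) * ε) :=
          mul_le_mul_of_nonneg_right (by linarith) (mul_nonneg (Real.sqrt_nonneg _) hε)
        _ = 2 * ε * qRad η (z x) := by ring
    -- (ii) `w₂ ≥ k a² − ε`
    have h2 : k * (z x).1 ^ 2 - ε ≤ (w x).2 := by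
      have h := abs_snd_sub_le (hdef x hx)
      have hV : (quadVF k η (z x)).2 = k * (z x).1 ^ 2 := rfl
      rw [hV] at h
      linarith [(abs_le.1 h).1]
    -- (iii) `a² = f · (R + √η b)` and `k√η a² ≥ κ f`
    have hid : (z x).1 ^ 2 = f x * (qRad η (z x) + Real.sqrt η * (z x).2) := by
      have : f x * (qRad η (z x) + Real.sqrt η * (z x).2)
          = qRad η (z x) ^ 2 - Real.sqrt η ^ 2 * (z x).2 ^ 2 := by simp only [hfdef]; ring
      rw [this, hR2, hse]; ring
    have hf0 : 0 ≤ f x := by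
      have := sqrt_mul_abs_snd_le_qRad hη0 (z x)
      have h' : Real.sqrt η * (z x).2 ≤ Real.sqrt η * |(z x).2| :=
        mul_le_mul_of_nonneg_left (le_abs_self _) hs0
      simp only [hfdef]; linarith
    have h3 : κ * f x ≤ k * Real.sqrt η * (z x).1 ^ 2 := by
      rw [hid]
      calc κ * f x ≤ (k * Real.sqrt η * (qRad η (z x) + Real.sqrt η * (z x).2)) * f x := by
            gcongr; exact hκ x hx
        _ = k * Real.sqrt η * (f x * (qRad η (z x) + Real.sqrt η * (z x).2)) := by ring
    -- assemble: `f' ≤ 2ε − √η w₂ ≤ 2ε − √η (k a² − ε) ≤ 3ε − κ f`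
    have h4 : Real.sqrt η * (k * (z x).1 ^ 2 - ε) ≤ Real.sqrt η * (w x).2 :=
      mul_le_mul_of_nonneg_left h2 hs0
    nlinarith [h1, h3, h4, mul_nonneg hs0 hε]
  intro t ht
  have h := le_gronwallBound_of_liminf_deriv_right_le (f := f)
    (f' := fun x => (2 * ((z x).1 * (w x).1 + η * (z x).2 * (w x).2)) /
      (2 * Real.sqrt (pairEnergy η (z x))) - Real.sqrt η * (w x).2)
    (δ := f 0) (K := -κ) (ε := 3 * ε) (a := 0) (b := T) hf
    (fun x hx r hr => by
      simpa [slope_def_module, smul_eq_mul] using (hf' x hx).liminf_right_slope_le hr)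
    le_rfl bound t ht
  have hκne : -κ ≠ 0 := by linarith
  simp only [gronwallBound_of_K_ne_0 hκne, sub_zero] at h
  have hexp1 : Real.exp (-κ * t) ≤ 1 := by
    rw [Real.exp_le_one_iff]; nlinarith [ht.1, hκ0]
  have hexp0 : 0 < Real.exp (-κ * t) := Real.exp_pos _
  have hlast : 3 * ε / -κ * (Real.exp (-κ * t) - 1) ≤ 3 * ε / κ := by
    have : 3 * ε / -κ * (Real.exp (-κ * t) - 1) = 3 * ε / κ * (1 - Real.exp (-κ * t)) := by
      field_simp; ring
    rw [this]
    have h3 : 0 ≤ 3 * ε / κ := by positivity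
    nlinarith [hexp0]
  simp only [hfdef] at h ⊢
  linarith [h, hlast]

end BlockDesign

end Summit.NavierStokesRegularity.FluidComputer
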